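import Summits.NavierStokesRegularity.NavierStokesRegularity.Theorems.SqueezeCycleRecurrentLiouvilleApexShellBound
import HarnessLib

/-!
# Crux `RecurrentLiouville` (stmt-NavierStokesRegularity-1589), line `Sketch` — stub S1b
# `stub_satApexOfNoSatellites`: the apex bound from a satellite-free hull

Theorems-only file (no definitions, no named facts).  Part 2 of stub S1b of line `Sketch` (lead
`prover-line-stmt-NavierStokesRegularity-1589-c2-0`).  A uniformly recurrent, origin-singular
member `(u, p, G, C)` of the crux's class (suitable weak on `ℝ³ × ℝ₋`, weak gradient,
Albritton–Barker `𝐈 < ∞`, rate `‖u(t,x)‖ ≤ C/√(−t)`) whose SCALING HULL IS SATELLITE-FREE is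
a.e. equal on the slab to a member `w` of the APEX class `‖w(t,x)‖ ≤ C'/(‖x‖ + √(−t))`
(KNSS 2009, (1.6)) with the same pressure and gradient, still uniformly recurrent and singular.

Proof.  Part 1 (`stub_satApexShellBound`, `…ApexShellBound.lean`): the rescalings `u_c` are
essentially bounded by `K` on `Q((0, ŷ), r)` uniformly in `c > 0` and `1 ≤ ‖ŷ‖ ≤ 2`.  A finite
`r`-net `T` of the shell and the scales `c = 2ᵏ`, `k ∈ ℤ`, give countably many backward balls
`Q((0, 2ᵏŷ), 2ᵏr)` on which `‖u‖ ≤ K/2ᵏ` a.e. (`eLpNorm_top_nsZoom`); every `(t, x)` with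
`x ≠ 0` and `−t < (2ᵏr)²`, `2ᵏ ≤ ‖x‖ < 2ᵏ⁺¹`, lies in one of them, so `‖u(t,x)‖ ≤ 2K/‖x‖` there,
while below these cones `‖x‖ ≤ 2√(−t)/r` and the rate gives `‖u‖ ≤ C(1 + 2/r)/(‖x‖ + √(−t))`.
Hence `‖u(t,x)‖ ≤ C'/(‖x‖ + √(−t))` a.e. with `C' = 4K + 2C + C(1 + 2/r)`;
`exists_apex_profile_repr` makes it pointwise and `IsScalingUniformlyRecurrent.congr_ae` carries
the recurrence over.

## References

* G. Koch, N. Nadirashvili, G. Seregin, V. Šverák, Acta Math. 203 (2009), (1.4), (1.6). [KNSS2009]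
* D. Albritton, T. Barker, J. Math. Fluid Mech. 21 (2019), no. 43 = arXiv:1811.00502, Lemma 2.2,
  Prop. 2.3, §3. [AlbrittonBarker2019]
-/

noncomputable section

-- the sub-problem namespace repeats the summit name (D-0017 layout `Summit.<S>.<P>.Theorems`)
set_option linter.dupNamespace false

namespace Summit.NavierStokesRegularity.NavierStokesRegularity.Theorems

open MeasureTheory Set Function Filter Topology TopologicalSpace Metric
open Literature.Analysis.FluidPDE
open scoped NNReal ENNReal

/-! ### Real arithmetic of the apex bound -/

/-- The elementary inequality behind the apex constant `C' = 4K + 2C + C(1 + 2/r)`: a value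
`a ≤ C/b` which is either `≤ 2K/n` (with `n > 0`) or taken at a point with `n ≤ 2b/r` satisfies
`a ≤ C'/(n + b)`. [folklore] -/
theorem satAS_apex_arith {a n b K C r : ℝ} (ha : 0 ≤ a) (hn : 0 ≤ n) (hb : 0 < b) (hK : 0 ≤ K)
    (hC : 0 ≤ C) (hr : 0 < r) (hrate : a ≤ C / b)
    (halt : (a ≤ 2 * K / n ∧ 0 < n) ∨ n ≤ 2 * b / r) :
    a ≤ (4 * K + 2 * C + C * (1 + 2 / r)) / (n + b) := by
  have hden : 0 < n + b := by linarith
  have hab : a * b ≤ C := (le_div_iff₀ hb).1 hrate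
  have h2r : 0 ≤ 2 / r := by positivity
  have hC' : 0 ≤ C * (1 + 2 / r) := by positivity
  rw [le_div_iff₀ hden]
  rcases halt with ⟨haK, hn0⟩ | hcone
  · have han : a * n ≤ 2 * K := (le_div_iff₀ hn0).1 haK
    rcases le_or_gt b n with hbn | hnb
    · nlinarith
    · nlinarith
  · have h1 : a * (n + b) ≤ a * (2 * b / r + b) := by nlinarith
    have h2 : a * (2 * b / r + b) = a * b * (1 + 2 / r) := by ring
    have h3 : a * b * (1 + 2 / r) ≤ C * (1 + 2 / r) := by nlinarith
    nlinarith

/-! ### S1b — the apex bound from a satellite-free hull -/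

/-- **S1b, the apex bound from a satellite-free hull** (registered stub of line `Sketch`).  A
uniformly recurrent, origin-singular member `(u, p, G, C)` of the crux's class whose scaling hull
is satellite-free (every `L³_loc`-limit of rescalings `u_{c_n}` that is again a singular class
profile has no backward singular point `(0, x)`, `x ≠ 0`) is a.e. equal on the slab to a field
`w` of the APEX class `‖w(t,x)‖ ≤ C'/(‖x‖ + √(−t))` with the same pressure and gradient, `𝐈 < ⊤`,
still uniformly recurrent and singular at the origin.  Proof: the uniform shell bound
(`stub_satApexShellBound`: persistence of singularities at translated centres), a finite `r`-net
of the shell, dyadic scaling of the essential bounds (`eLpNorm_top_nsZoom`), the rate below the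
cones (`satAS_apex_arith`), `exists_apex_profile_repr` and `IsScalingUniformlyRecurrent.congr_ae`.
[cite: AlbrittonBarker2019, Prop. 2.3 and §3] [cite: KNSS2009, (1.6)] -/
theorem stub_satApexOfNoSatellites :
    ∀ (u : ℝ → EuclideanSpace ℝ (Fin 3) → EuclideanSpace ℝ (Fin 3))
      (p : ℝ → EuclideanSpace ℝ (Fin 3) → ℝ)
      (G : ℝ → EuclideanSpace ℝ (Fin 3) → EuclideanSpace ℝ (Fin 3) →L[ℝ] EuclideanSpace ℝ (Fin 3)) (C : ℝ),
      IsSuitableWeakSolutionOn (slab (EuclideanSpace ℝ (Fin 3)) (Iio 0) isOpen_Iio) 1 0 u p →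
      HasWeakSpatialGradientOn (slab (EuclideanSpace ℝ (Fin 3)) (Iio 0) isOpen_Iio) u G →
      typeIBound (Iio (0 : ℝ) ×ˢ univ) u p G < ⊤ → HasTypeITimeDecay C u →
      IsScalingUniformlyRecurrent u → IsBackwardSingularPoint u 0 →
      (∀ (c : ℕ → ℝ) (v : ℝ → EuclideanSpace ℝ (Fin 3) → EuclideanSpace ℝ (Fin 3))
        (q : ℝ → EuclideanSpace ℝ (Fin 3) → ℝ)
        (H : ℝ → EuclideanSpace ℝ (Fin 3) → EuclideanSpace ℝ (Fin 3) →L[ℝ] EuclideanSpace ℝ (Fin 3)),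
        (∀ n, 0 < c n) →
        IsSuitableWeakSolutionOn (slab (EuclideanSpace ℝ (Fin 3)) (Iio 0) isOpen_Iio) 1 0 v q →
        HasWeakSpatialGradientOn (slab (EuclideanSpace ℝ (Fin 3)) (Iio 0) isOpen_Iio) v H →
        typeIBound (Iio (0 : ℝ) ×ˢ univ) v q H < ⊤ → HasTypeITimeDecay C v →
        IsBackwardSingularPoint v 0 →
        (∀ R : ℝ, 0 < R → Tendsto (fun n => eLpNorm (uncurry (nsRescale (c n) u) - uncurry v) 3
          (volume.restrict (parabolicCylinder R (0 : ℝ × EuclideanSpace ℝ (Fin 3))))) atTop (𝓝 0)) →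
        ∀ x : EuclideanSpace ℝ (Fin 3), x ≠ 0 → ¬ IsBackwardSingularPoint v (0, x)) →
      ∃ (w : ℝ → EuclideanSpace ℝ (Fin 3) → EuclideanSpace ℝ (Fin 3)) (C' : ℝ),
        (∀ᵐ z ∂(volume.restrict (Iio (0 : ℝ) ×ˢ (univ : Set (EuclideanSpace ℝ (Fin 3))))),
          uncurry u z = uncurry w z) ∧
        IsSuitableWeakSolutionOn (slab (EuclideanSpace ℝ (Fin 3)) (Iio 0) isOpen_Iio) 1 0 w p ∧
        HasWeakSpatialGradientOn (slab (EuclideanSpace ℝ (Fin 3)) (Iio 0) isOpen_Iio) w G ∧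
        typeIBound (Iio (0 : ℝ) ×ˢ univ) w p G < ⊤ ∧ HasTypeIDecay C' w ∧
        IsScalingUniformlyRecurrent w ∧ IsBackwardSingularPoint w 0 := by
  intro u p G C hsw hwg hI hdec hrec hsing hhull
  -- `0 ≤ C`, from the rate at `(t, x) = (-1, 0)`
  have hC0 : 0 ≤ C := by
    have h := hdec (-1) (by norm_num) 0
    have h1 : (0 : ℝ) ≤ C / Real.sqrt (-(-1 : ℝ)) := (norm_nonneg _).trans h
    rw [neg_neg, Real.sqrt_one, div_one] at h1
    exact h1
  -- ## the uniform shell bound (part 1)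
  obtain ⟨r, hr0, -, K, hK⟩ := stub_satApexShellBound u p G C hsw hwg hI hdec hsing hhull
  have hK0 : (0 : ℝ) ≤ K := K.2
  -- ## a finite `r`-net of the shell `1 ≤ ‖ŷ‖ ≤ 2`
  set S : Set (EuclideanSpace ℝ (Fin 3)) := closedBall 0 2 ∩ (ball 0 1)ᶜ with hSdef
  have hS : IsCompact S := (isCompact_closedBall _ _).inter_right isOpen_ball.isClosed_compl
  obtain ⟨T, hTS, hTfin, hTcov⟩ := finite_cover_balls_of_compact hS hr0
  -- ## essential bounds on the scaled balls `Q((0, 2ᵏŷ), 2ᵏr)`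
  have hball : ∀ (k : ℤ) (ŷ : EuclideanSpace ℝ (Fin 3)), ŷ ∈ T →
      ∀ᵐ z ∂(volume : Measure (ℝ × EuclideanSpace ℝ (Fin 3))),
        z ∈ parabolicCylinder ((2 : ℝ) ^ k * r) ((0 : ℝ), ((2 : ℝ) ^ k) • ŷ) →
          ‖uncurry u z‖ ≤ (K : ℝ) / (2 : ℝ) ^ k := by
    intro k ŷ hŷ
    have hc : (0 : ℝ) < (2 : ℝ) ^ k := zpow_pos (by norm_num) k
    have hŷ1 : 1 ≤ ‖ŷ‖ := by
      have h := (hTS hŷ).2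
      rw [mem_compl_iff, mem_ball_zero_iff, not_lt] at h
      exact h
    have hŷ2 : ‖ŷ‖ ≤ 2 := mem_closedBall_zero_iff.1 (hTS hŷ).1
    have h1 := hK _ hc ŷ hŷ1 hŷ2
    rw [nsRescale_eq_zoom, eLpNorm_top_nsZoom hc 0 0 r ((0 : ℝ), ŷ) u] at h1
    have e : stAffine (((2 : ℝ) ^ k) ^ 2) ((2 : ℝ) ^ k) 0 0 ((0 : ℝ), ŷ) =
        ((0 : ℝ), ((2 : ℝ) ^ k) • ŷ) := by
      ext <;> simp [stAffine_apply]
    rw [e] at h1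
    set μ : Measure (ℝ × EuclideanSpace ℝ (Fin 3)) :=
      volume.restrict (parabolicCylinder ((2 : ℝ) ^ k * r) ((0 : ℝ), ((2 : ℝ) ^ k) • ŷ)) with hμ
    have h2 : eLpNorm (uncurry u) ∞ μ ≤ (K : ℝ≥0∞) / ENNReal.ofReal ((2 : ℝ) ^ k) := by
      rw [ENNReal.le_div_iff_mul_le (Or.inl (ENNReal.ofReal_pos.2 hc).ne') (Or.inl ENNReal.ofReal_ne_top),
        mul_comm]
      exact h1
    have hKe : (K : ℝ≥0∞) / ENNReal.ofReal ((2 : ℝ) ^ k) = ENNReal.ofReal ((K : ℝ) / (2 : ℝ) ^ k) := by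
      rw [ENNReal.ofReal_div_of_pos hc, ENNReal.ofReal_coe_nnreal]
    have h3 : ∀ᵐ z ∂μ, ‖uncurry u z‖ ≤ (K : ℝ) / (2 : ℝ) ^ k := by
      filter_upwards [enorm_ae_le_eLpNormEssSup (uncurry u) μ] with z hz
      have h2' : eLpNormEssSup (uncurry u) μ ≤ ENNReal.ofReal ((K : ℝ) / (2 : ℝ) ^ k) := by
        rw [← hKe, ← eLpNorm_exponent_top]
        exact h2
      have h4 : ‖uncurry u z‖ₑ ≤ ENNReal.ofReal ((K : ℝ) / (2 : ℝ) ^ k) := hz.trans h2'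
      rw [← ofReal_norm] at h4
      exact (ENNReal.ofReal_le_ofReal_iff (by positivity)).1 h4
    rw [hμ, ae_restrict_iff' (isOpen_parabolicCylinder _ _).measurableSet] at h3
    exact h3
  -- all of them at once, almost everywhere
  have hall : ∀ᵐ z ∂(volume : Measure (ℝ × EuclideanSpace ℝ (Fin 3))), ∀ k : ℤ, ∀ ŷ ∈ T,
      z ∈ parabolicCylinder ((2 : ℝ) ^ k * r) ((0 : ℝ), ((2 : ℝ) ^ k) • ŷ) →
        ‖uncurry u z‖ ≤ (K : ℝ) / (2 : ℝ) ^ k := by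
    rw [ae_all_iff]
    intro k
    rw [ae_ball_iff hTfin.countable]
    intro ŷ hŷ
    exact hball k ŷ hŷ
  -- ## the apex bound almost everywhere on the slab
  set C' : ℝ := 4 * K + 2 * C + C * (1 + 2 / r) with hC'
  have hapex : ∀ᵐ z ∂(volume.restrict (Iio (0 : ℝ) ×ˢ (univ : Set (EuclideanSpace ℝ (Fin 3))))),
      ‖u z.1 z.2‖ ≤ C' / (‖z.2‖ + Real.sqrt (-z.1)) := by
    filter_upwards [ae_restrict_of_ae hall,
      ae_restrict_mem (measurableSet_Iio.prod MeasurableSet.univ)] with z hz hzmem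
    obtain ⟨s, x⟩ := z
    have hs : s < 0 := by simpa using hzmem
    have hb : 0 < Real.sqrt (-s) := Real.sqrt_pos.2 (by linarith)
    have hrate : ‖u s x‖ ≤ C / Real.sqrt (-s) := hdec s hs x
    show ‖u s x‖ ≤ C' / (‖x‖ + Real.sqrt (-s))
    refine satAS_apex_arith (norm_nonneg _) (norm_nonneg _) hb hK0 hC0 hr0 hrate ?_
    by_cases hx : x = 0
    · right
      rw [hx, norm_zero]
      positivity
    -- the dyadic scale of `x`
    obtain ⟨k, hk1, hk2⟩ := exists_mem_Ico_zpow (norm_pos_iff.2 hx) (one_lt_two (α := ℝ))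
    have hc : (0 : ℝ) < (2 : ℝ) ^ k := zpow_pos (by norm_num) k
    have hk2' : ‖x‖ < 2 * (2 : ℝ) ^ k := by
      rw [zpow_add_one₀ (two_ne_zero (α := ℝ))] at hk2
      linarith
    -- `y = 2⁻ᵏ x` lies on the shell, hence in a ball of the net
    have hyS : ((2 : ℝ) ^ k)⁻¹ • x ∈ S := by
      have hn : ‖((2 : ℝ) ^ k)⁻¹ • x‖ = ((2 : ℝ) ^ k)⁻¹ * ‖x‖ := by
        rw [norm_smul, Real.norm_of_nonneg (inv_nonneg.2 hc.le)]
      refine ⟨mem_closedBall_zero_iff.2 ?_, fun h => ?_⟩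
      · rw [hn, inv_mul_le_iff₀ hc]
        linarith
      · rw [mem_ball_zero_iff, hn, inv_mul_lt_iff₀ hc] at h
        linarith
    obtain ⟨ŷ, hŷT, hŷ⟩ := mem_iUnion₂.1 (hTcov hyS)
    rw [mem_ball, dist_eq_norm] at hŷ
    by_cases ht : -s < ((2 : ℝ) ^ k * r) ^ 2
    · -- above the cone: inside `Q((0, 2ᵏŷ), 2ᵏr)`
      left
      refine ⟨?_, norm_pos_iff.2 hx⟩
      have hzQ : ((s, x) : ℝ × EuclideanSpace ℝ (Fin 3)) ∈
          parabolicCylinder ((2 : ℝ) ^ k * r) ((0 : ℝ), ((2 : ℝ) ^ k) • ŷ) := by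
        rw [mem_parabolicCylinder]
        refine ⟨⟨by simp only; linarith, hs⟩, ?_⟩
        have e : x - ((2 : ℝ) ^ k) • ŷ = ((2 : ℝ) ^ k) • (((2 : ℝ) ^ k)⁻¹ • x - ŷ) := by
          rw [smul_sub, smul_inv_smul₀ hc.ne']
        simp only
        rw [dist_eq_norm, e, norm_smul, Real.norm_of_nonneg hc.le]
        exact mul_lt_mul_of_pos_left hŷ hc
      have hbd : ‖u s x‖ ≤ (K : ℝ) / (2 : ℝ) ^ k := hz k ŷ hŷT hzQ
      calc ‖u s x‖ ≤ (K : ℝ) / (2 : ℝ) ^ k := hbd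
        _ = 2 * K / (2 * (2 : ℝ) ^ k) := by field_simp
        _ ≤ 2 * K / ‖x‖ :=
          div_le_div_of_nonneg_left (by positivity) (norm_pos_iff.2 hx) hk2'.le
    · -- below the cone: `2ᵏ r ≤ √(−s)`, so `‖x‖ < 2·2ᵏ ≤ 2 √(−s) / r`
      right
      have h1 : (2 : ℝ) ^ k * r ≤ Real.sqrt (-s) := by
        rw [Real.le_sqrt' (by positivity)]
        linarith
      rw [le_div_iff₀ hr0]
      nlinarith

  -- ## the pointwise apex representative
  obtain ⟨w, hae, hsww, hwgw, hIw, hdecw, hsingw⟩ :=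
    exists_apex_profile_repr (by positivity : (0 : ℝ) ≤ C') hsw hwg hI hsing hapex
  have hrecw : IsScalingUniformlyRecurrent w :=
    hrec.congr_ae (by filter_upwards [hae] with z hz; exact hz)
  exact ⟨w, C', hae, hsww, hwgw, hIw, hdecw, hrecw, hsingw⟩

end Summit.NavierStokesRegularity.NavierStokesRegularity.Theorems

end
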